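import Literature.IUT.HodgeArakelov.LocalTriMuDataIsoArch

/-!
# [IUTchII] Def 4.9 (ii)–(vii): print-level isomorphisms of `F^{⊢▶×μ}`-data — `O^{▶×μ} = O^▶ × O^{×μ}`

Owner file (abc-iut cell, layer L6; abc-iut-L6-t2; nothing landed is re-typed). S. Mochizuki, *Inter-universal
Teichmüller theory II*, kurims Dec-2020 manuscript, Def 4.9 (ii) p. 155 / (iv) p. 156: "`O^{▶×μ}(‡A) :=
O^▶(‡A) × O^{×μ}(‡A)` for the direct product monoid … determines a model Frobenioid equipped with a splitting, i.e.,
the splitting arising from the definition of `O^{▶×μ}(‡A)` as a direct product"; (vii) p. 158: "A morphism of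
`F^{⊢▶×μ}`-prime-strips is … a collection of isomorphisms, indexed by `V`, between the various constituent
objects". [claim: Mochizuki2012, status: disputed]; nothing here takes a side on [IUTchIII] Cor 3.12.
`KummerPrimeStrips.lean` (p405008, frozen) types `O^▶ = O^▷/O^×` as `OTri O := Associates O` and the direct
product as `OTriTimesMu O`. `LocalTriMuDataIso.lean` (p410596) typed the `O^▷`-LEVEL isomorphisms
`NonarchTriMuDatum.Iso` (the morphisms of the underlying `F^⊢`-prime-strip data) and `MuIso` (the
`F^{⊢×μ}`-morphisms), with `Iso.toMuIso`; abc-iut-w4-d028's kernel witness (p411899) shows `Iso.toMuIso` is NOT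
surjective, whereas [IUTchII] Cor 4.10 (iv) / [IUTchIII] Thm 1.5 (ii) use that "passing to `F^{⊢×μ}`" is surjective
on isomorphisms. At PRINT level this is formal, because the monoid of `‡F^{⊢▶×μ}_w` is the DIRECT PRODUCT
`O^▶ × O^{×μ}`: an isomorphism of the split data is a PAIR (isomorphism of the `O^▶`-parts, isomorphism of the
`O^{×μ}`-parts with their Kummer structures), no constraint linking the two. This file types that successor notion:
§0 `OTri.map`, `OTri.mapEquiv` (functoriality of `O^▶`, also the transport of the valuations `ρ_v : O^▶ → ℝ_{≥0}`);
§1 `NonarchTriMuDatum.SplitIso D D' := (eTri : O^▶ ⥲ O^▶ equivariant, mu : MuIso D D')`, groupoid laws,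
`Iso.toSplitIso`, `SplitIso.toMuIso` and its SURJECTIVITY given one split isomorphism (PROVED); §2 the archimedean
analogue; §3 `LocalTriMuDatum.SplitIso` by type of place. The strip-level groupoid and the FULL functor to
`F^{⊢×μ}`-prime-strips follow in a sequel; the `O^▷`-level `Iso` stays as the `F^⊢`-prime-strip notion.
-/

namespace Literature.IUT.HodgeArakelov

universe u v w

/-! ### 0. Functoriality of `O^▶ = O^▷/O^×` -/

namespace OTri

variable {O : Type v} [CommMonoid O] {O' : Type v} [CommMonoid O'] {O'' : Type v} [CommMonoid O'']

/-- `O^▶(−) = O^▷(−)/O^×(−)` is functorial in monoid homomorphisms (associated elements map to associated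
elements). (bookkeeping). [cite: Mochizuki2012, Def 4.9 (ii) p.155] -/
def map (f : O →* O') : OTri O →* OTri O' where
  toFun a := Quotient.liftOn a (fun x => Associates.mk (f x))
    (fun _ _ (h : Associated _ _) => Associates.mk_eq_mk_iff_associated.2 (h.map f))
  map_one' := by
    show Associates.mk (f 1) = Associates.mk 1
    rw [map_one]
  map_mul' a b := Quotient.inductionOn₂ a b fun x y => by
    show Associates.mk (f (x * y)) = Associates.mk (f x) * Associates.mk (f y)
    rw [map_mul, Associates.mk_mul_mk]

/-- `O^▶(f)` on classes (bookkeeping). [cite: Mochizuki2012, Def 4.9 (ii) p.155] -/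
@[simp] theorem map_mk (f : O →* O') (x : O) : map f (Associates.mk x) = Associates.mk (f x) := rfl

/-- `O^▶(f)` is compatible with the projections `O^▷ ↠ O^▶` (bookkeeping). [cite: Mochizuki2012, Def 4.9 (ii) p.155] -/
theorem map_comp_toOTri (f : O →* O') : (map f).comp (toOTri O) = (toOTri O').comp f := MonoidHom.ext fun _ => rfl

/-- `O^▶(−)` on an isomorphism `O^▷ ⥲ O^▷'` (bookkeeping). [cite: Mochizuki2012, Def 4.9 (ii) p.155] -/
def mapEquiv (e : O ≃* O') : OTri O ≃* OTri O' :=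
  { map e.toMonoidHom with
    invFun := map e.symm.toMonoidHom
    left_inv := Quotient.ind fun x => by
      show Associates.mk (e.symm (e x)) = Associates.mk x
      rw [MulEquiv.symm_apply_apply]
    right_inv := Quotient.ind fun y => by
      show Associates.mk (e (e.symm y)) = Associates.mk y
      rw [MulEquiv.apply_symm_apply] }

/-- `O^▶(e)` on classes (bookkeeping). [cite: Mochizuki2012, Def 4.9 (ii) p.155] -/
@[simp] theorem mapEquiv_mk (e : O ≃* O') (x : O) : mapEquiv e (Associates.mk x) = Associates.mk (e x) := rfl

/-- `O^▶(id) = id` (bookkeeping). [cite: Mochizuki2012, Def 4.9 (ii) p.155] -/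
theorem mapEquiv_refl : mapEquiv (MulEquiv.refl O) = MulEquiv.refl (OTri O) :=
  MulEquiv.ext (Quotient.ind fun _ => rfl)

/-- `O^▶(e ≫ e') = O^▶(e) ≫ O^▶(e')` (bookkeeping). [cite: Mochizuki2012, Def 4.9 (ii) p.155] -/
theorem mapEquiv_trans (e : O ≃* O') (e' : O' ≃* O'') :
    mapEquiv (e.trans e') = (mapEquiv e).trans (mapEquiv e') :=
  MulEquiv.ext (Quotient.ind fun _ => rfl)

/-- `O^▶(e⁻¹) = O^▶(e)⁻¹` (bookkeeping). [cite: Mochizuki2012, Def 4.9 (ii) p.155] -/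
theorem mapEquiv_symm (e : O ≃* O') : mapEquiv e.symm = (mapEquiv e).symm :=
  MulEquiv.ext fun _ => rfl

end OTri

/-! ### 1. Nonarchimedean places: split isomorphisms `(O^▶ ⥲ O^▶) × (×μ-isomorphism)` -/

namespace NonarchTriMuDatum

variable {l : ℕ} {k : PlaceKind} {G : Type u} [Group G] {X : GroupTheoreticUnits.{u, w} G}

/-- The `‡G`-action on `O^▶(‡A)` induced by the action on `O^▷(‡A)` ("the monoids `O^▷(‡A)`, …, `O^▶(‡A)`, …,
`O^{▶×μ}(‡A)` are all equipped with natural `‡G`-actions", Def 4.9 (ii) p. 155). [cite: Mochizuki2012, Def 4.9 (ii) p.155] -/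
def actTri (D : NonarchTriMuDatum.{u, v, w} l k G X) (g : G) : OTri D.O ≃* OTri D.O := OTri.mapEquiv (D.act g)

/-- **A print-level isomorphism of the nonarchimedean data `‡F^{⊢▶×μ}_w ⥲ ‡F'^{⊢▶×μ}_w`** (Def 4.9 (ii)–(iv), (vii)):
since the monoid of the split-Kummer Frobenioid `‡F^{⊢▶×μ}_w` is the DIRECT PRODUCT `O^{▶×μ} = O^▶ × O^{×μ}` with its
splitting, an isomorphism of these data is a PAIR — an equivariant isomorphism of the `O^▶`-parts and an
isomorphism of the `O^{×μ}`-parts carrying the `×μ`-Kummer structure (`MuIso`) — with no constraint linking the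
two components. [cite: Mochizuki2012, Def 4.9 (vii) p.158] -/
structure SplitIso (D D' : NonarchTriMuDatum.{u, v, w} l k G X) : Type (max u v w) where
  /-- `O^▶(‡A) ⥲ O^▶(‡A')` -/
  eTri : OTri D.O ≃* OTri D'.O
  /-- equivariance of `eTri` -/
  map_actTri : ∀ (g : G) (a : OTri D.O), eTri (D.actTri g a) = D'.actTri g (eTri a)
  /-- the `O^{×μ}`-component with its Kummer structure -/
  mu : MuIso D D'

namespace SplitIso

variable {D D' D'' D''' : NonarchTriMuDatum.{u, v, w} l k G X}

/-- A split isomorphism is determined by its two components. (bookkeeping). [cite: Mochizuki2012, Def 4.9 (vii) p.158] -/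
theorem ext' {f f' : SplitIso D D'} (h₁ : f.eTri = f'.eTri) (h₂ : f.mu = f'.mu) : f = f' := by
  cases f; cases f'; cases h₁; cases h₂; rfl

variable (D) in
/-- Identity. [cite: Mochizuki2012, Def 4.9 (vii) p.158] -/
def refl : SplitIso D D := ⟨MulEquiv.refl _, fun _ _ => rfl, MuIso.refl D⟩

/-- Composite (componentwise). [cite: Mochizuki2012, Def 4.9 (vii) p.158] -/
def trans (f : SplitIso D D') (f' : SplitIso D' D'') : SplitIso D D'' where
  eTri := f.eTri.trans f'.eTri
  map_actTri g a := by rw [MulEquiv.trans_apply, f.map_actTri, f'.map_actTri, MulEquiv.trans_apply]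
  mu := f.mu.trans f'.mu

/-- Inverse (componentwise). [cite: Mochizuki2012, Def 4.9 (vii) p.158] -/
def symm (f : SplitIso D D') : SplitIso D' D where
  eTri := f.eTri.symm
  map_actTri g b := f.eTri.injective (by rw [MulEquiv.apply_symm_apply, f.map_actTri, MulEquiv.apply_symm_apply])
  mu := f.mu.symm

/-- `refl ≫ f = f`. (bookkeeping). [cite: Mochizuki2012, Def 4.9 (vii) p.158] -/
theorem refl_trans (f : SplitIso D D') : (refl D).trans f = f :=
  ext' (MulEquiv.ext fun _ => rfl) (MuIso.refl_trans f.mu)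

/-- `f ≫ refl = f`. (bookkeeping). [cite: Mochizuki2012, Def 4.9 (vii) p.158] -/
theorem trans_refl (f : SplitIso D D') : f.trans (refl D') = f :=
  ext' (MulEquiv.ext fun _ => rfl) (MuIso.trans_refl f.mu)

/-- Associativity. (bookkeeping). [cite: Mochizuki2012, Def 4.9 (vii) p.158] -/
theorem trans_assoc (f : SplitIso D D') (f' : SplitIso D' D'') (f'' : SplitIso D'' D''') :
    (f.trans f').trans f'' = f.trans (f'.trans f'') :=
  ext' (MulEquiv.ext fun _ => rfl) (MuIso.trans_assoc f.mu f'.mu f''.mu)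

/-- `f ≫ f⁻¹ = refl`. (bookkeeping). [cite: Mochizuki2012, Def 4.9 (vii) p.158] -/
theorem trans_symm (f : SplitIso D D') : f.trans f.symm = refl D :=
  ext' (MulEquiv.ext fun a => f.eTri.symm_apply_apply a) (MuIso.trans_symm f.mu)

/-- `f⁻¹ ≫ f = refl`. (bookkeeping). [cite: Mochizuki2012, Def 4.9 (vii) p.158] -/
theorem symm_trans (f : SplitIso D D') : f.symm.trans f = refl D' :=
  ext' (MulEquiv.ext fun b => f.eTri.apply_symm_apply b) (MuIso.symm_trans f.mu)

/-- **"Passing to `F^{⊢×μ}`" on print-level morphisms**: the `O^{×μ}`-component (functorial by `rfl`).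
[cite: Mochizuki2012, Def 4.9 (vii) p.158] -/
def toMuIso (f : SplitIso D D') : MuIso D D' := f.mu

/-- **Surjectivity of "passing to `F^{⊢×μ}`" at print level** (the point of the direct-product definition, used
in [IUTchII] Cor 4.10 (iv)): as soon as ONE split isomorphism `D ⥲ D'` exists, every `×μ`-isomorphism is the
`O^{×μ}`-component of a split isomorphism. PROVED (pair the given `O^▶`-component with it).
[cite: Mochizuki2012, Def 4.9 (vii) p.158] -/
theorem toMuIso_surjective_of_nonempty (h : Nonempty (SplitIso D D')) :
    Function.Surjective (toMuIso : SplitIso D D' → MuIso D D') :=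
  fun m => h.elim fun s => ⟨⟨s.eTri, s.map_actTri, m⟩, rfl⟩

variable (D) in
/-- Every `×μ`-automorphism lifts to a split automorphism. [cite: Mochizuki2012, Def 4.9 (vii) p.158] -/
theorem toMuIso_surjective_self : Function.Surjective (toMuIso : SplitIso D D → MuIso D D) :=
  toMuIso_surjective_of_nonempty ⟨refl D⟩

end SplitIso

/-- An `O^▷`-level isomorphism (`Iso`, the `F^⊢`-prime-strip morphism) induces a print-level split isomorphism:
`(O^▶(e), e mod torsion on units)`. [cite: Mochizuki2012, Def 4.9 (vii) p.158] -/
def Iso.toSplitIso {D D' : NonarchTriMuDatum.{u, v, w} l k G X} (f : Iso D D') : SplitIso D D' where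
  eTri := OTri.mapEquiv f.e
  map_actTri g := Quotient.ind fun x => by
    show Associates.mk (f.e (D.act g x)) = Associates.mk (D'.act g (f.e x))
    rw [f.map_act]
  mu := f.toMuIso

/-- `toSplitIso` then `toMuIso` is `toMuIso` (bookkeeping). [cite: Mochizuki2012, Def 4.9 (vii) p.158] -/
theorem Iso.toMuIso_toSplitIso {D D' : NonarchTriMuDatum.{u, v, w} l k G X} (f : Iso D D') :
    f.toSplitIso.toMuIso = f.toMuIso := rfl

/-- `toSplitIso` respects identities (bookkeeping). [cite: Mochizuki2012, Def 4.9 (vii) p.158] -/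
theorem Iso.toSplitIso_refl (D : NonarchTriMuDatum.{u, v, w} l k G X) : (Iso.refl D).toSplitIso = SplitIso.refl D :=
  SplitIso.ext' (MulEquiv.ext (Quotient.ind fun _ => rfl)) (Iso.toMuIso_refl D)

/-- `toSplitIso` respects composition (bookkeeping). [cite: Mochizuki2012, Def 4.9 (vii) p.158] -/
theorem Iso.toSplitIso_trans {D D' D'' : NonarchTriMuDatum.{u, v, w} l k G X} (f : Iso D D') (f' : Iso D' D'') :
    (f.trans f').toSplitIso = f.toSplitIso.trans f'.toSplitIso :=
  SplitIso.ext' (MulEquiv.ext (Quotient.ind fun _ => rfl)) (Iso.toMuIso_trans f f')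

/-- Hence "passing to `F^{⊢×μ}`" from split isomorphisms is surjective whenever an `O^▷`-level isomorphism exists
(e.g. between the local data of two `F^{⊢▶×μ}`-prime-strips, both isomorphic to the model).
[cite: Mochizuki2012, Def 4.9 (vii) p.158] -/
theorem SplitIso.toMuIso_surjective_of_iso {D D' : NonarchTriMuDatum.{u, v, w} l k G X} (f : Iso D D') :
    Function.Surjective (SplitIso.toMuIso : SplitIso D D' → MuIso D D') :=
  SplitIso.toMuIso_surjective_of_nonempty ⟨f.toSplitIso⟩

end NonarchTriMuDatum

/-! ### 2. Archimedean places (Def 4.9 (v)): split isomorphisms -/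

namespace ArchTriMuDatum

/-- **A print-level isomorphism of the archimedean data `‡F^{⊢▶×μ}_w ⥲ ‡F'^{⊢▶×μ}_w`** (Def 4.9 (v), (vii)): a pair
— an isomorphism of the `O^▶`-parts and an isomorphism of the `×μ`-data (`MuIso`: units' inductive system with
the Kummer surjections from the circle). [cite: Mochizuki2012, Def 4.9 (vii) p.158] -/
structure SplitIso (D D' : ArchTriMuDatum.{v}) : Type v where
  /-- `O^▶ ⥲ O^▶` -/
  eTri : OTri D.O ≃* OTri D'.O
  /-- the `×μ`-component -/
  mu : MuIso D D'

namespace SplitIso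

variable {D D' D'' D''' : ArchTriMuDatum.{v}}

/-- Determined by the components. (bookkeeping). [cite: Mochizuki2012, Def 4.9 (vii) p.158] -/
theorem ext' {f f' : SplitIso D D'} (h₁ : f.eTri = f'.eTri) (h₂ : f.mu = f'.mu) : f = f' := by
  cases f; cases f'; cases h₁; cases h₂; rfl

variable (D) in
/-- Identity. [cite: Mochizuki2012, Def 4.9 (vii) p.158] -/
def refl : SplitIso D D := ⟨MulEquiv.refl _, MuIso.refl D⟩

/-- Composite. [cite: Mochizuki2012, Def 4.9 (vii) p.158] -/
def trans (f : SplitIso D D') (f' : SplitIso D' D'') : SplitIso D D'' := ⟨f.eTri.trans f'.eTri, f.mu.trans f'.mu⟩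

/-- Inverse. [cite: Mochizuki2012, Def 4.9 (vii) p.158] -/
def symm (f : SplitIso D D') : SplitIso D' D := ⟨f.eTri.symm, f.mu.symm⟩

/-- `refl ≫ f = f`. (bookkeeping). [cite: Mochizuki2012, Def 4.9 (vii) p.158] -/
theorem refl_trans (f : SplitIso D D') : (refl D).trans f = f :=
  ext' (MulEquiv.ext fun _ => rfl) (MuIso.refl_trans f.mu)

/-- `f ≫ refl = f`. (bookkeeping). [cite: Mochizuki2012, Def 4.9 (vii) p.158] -/
theorem trans_refl (f : SplitIso D D') : f.trans (refl D') = f :=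
  ext' (MulEquiv.ext fun _ => rfl) (MuIso.trans_refl f.mu)

/-- Associativity. (bookkeeping). [cite: Mochizuki2012, Def 4.9 (vii) p.158] -/
theorem trans_assoc (f : SplitIso D D') (f' : SplitIso D' D'') (f'' : SplitIso D'' D''') :
    (f.trans f').trans f'' = f.trans (f'.trans f'') :=
  ext' (MulEquiv.ext fun _ => rfl) (MuIso.trans_assoc f.mu f'.mu f''.mu)

/-- `f ≫ f⁻¹ = refl`. (bookkeeping). [cite: Mochizuki2012, Def 4.9 (vii) p.158] -/
theorem trans_symm (f : SplitIso D D') : f.trans f.symm = refl D :=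
  ext' (MulEquiv.ext fun a => f.eTri.symm_apply_apply a) (MuIso.trans_symm f.mu)

/-- `f⁻¹ ≫ f = refl`. (bookkeeping). [cite: Mochizuki2012, Def 4.9 (vii) p.158] -/
theorem symm_trans (f : SplitIso D D') : f.symm.trans f = refl D' :=
  ext' (MulEquiv.ext fun b => f.eTri.apply_symm_apply b) (MuIso.symm_trans f.mu)

/-- The `×μ`-component. [cite: Mochizuki2012, Def 4.9 (vii) p.158] -/
def toMuIso (f : SplitIso D D') : MuIso D D' := f.mu

/-- Surjectivity of "passing to `F^{⊢×μ}`" at archimedean places, given one split isomorphism. PROVED.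
[cite: Mochizuki2012, Def 4.9 (vii) p.158] -/
theorem toMuIso_surjective_of_nonempty (h : Nonempty (SplitIso D D')) :
    Function.Surjective (toMuIso : SplitIso D D' → MuIso D D') :=
  fun m => h.elim fun s => ⟨⟨s.eTri, m⟩, rfl⟩

end SplitIso

/-- An archimedean `Iso` induces a split isomorphism `(O^▶(e), toMuIso)`. [cite: Mochizuki2012, Def 4.9 (vii) p.158] -/
def Iso.toSplitIso {D D' : ArchTriMuDatum.{v}} (f : Iso D D') : SplitIso D D' := ⟨OTri.mapEquiv f.e, f.toMuIso⟩

/-- `toSplitIso` respects identities (bookkeeping). [cite: Mochizuki2012, Def 4.9 (vii) p.158] -/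
theorem Iso.toSplitIso_refl (D : ArchTriMuDatum.{v}) : (Iso.refl D).toSplitIso = SplitIso.refl D :=
  SplitIso.ext' (MulEquiv.ext (Quotient.ind fun _ => rfl)) (Iso.toMuIso_refl D)

/-- `toSplitIso` respects composition (bookkeeping). [cite: Mochizuki2012, Def 4.9 (vii) p.158] -/
theorem Iso.toSplitIso_trans {D D' D'' : ArchTriMuDatum.{v}} (f : Iso D D') (f' : Iso D' D'') :
    (f.trans f').toSplitIso = f.toSplitIso.trans f'.toSplitIso :=
  SplitIso.ext' (MulEquiv.ext (Quotient.ind fun _ => rfl)) (Iso.toMuIso_trans f f')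

end ArchTriMuDatum

/-! ### 3. By type of place -/

namespace LocalTriMuDatum

variable {l : ℕ} {G : Type u} [Group G] {X : GroupTheoreticUnits.{u, w} G}

/-- **A print-level isomorphism of local `F^{⊢▶×μ}`-data** by type of place: the split isomorphisms of §1 at bad
and good nonarchimedean places, of §2 (lifted) at archimedean places. [cite: Mochizuki2012, Def 4.9 (vii) p.158] -/
def SplitIso : {k : PlaceKind} → LocalTriMuDatum.{u, v, w} l G X k → LocalTriMuDatum.{u, v, w} l G X k →
    Type (max u v w)
  | _, .bad D, .bad D' => NonarchTriMuDatum.SplitIso D D'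
  | _, .good D, .good D' => NonarchTriMuDatum.SplitIso D D'
  | _, .arch D, .arch D' => ULift.{max u w} (ArchTriMuDatum.SplitIso D D')

/-- Identity. [cite: Mochizuki2012, Def 4.9 (vii) p.158] -/
def SplitIso.refl : {k : PlaceKind} → (D : LocalTriMuDatum.{u, v, w} l G X k) → SplitIso D D
  | _, .bad D => NonarchTriMuDatum.SplitIso.refl D
  | _, .good D => NonarchTriMuDatum.SplitIso.refl D
  | _, .arch D => ⟨ArchTriMuDatum.SplitIso.refl D⟩

/-- Composite. [cite: Mochizuki2012, Def 4.9 (vii) p.158] -/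
def SplitIso.trans : {k : PlaceKind} → {D D' D'' : LocalTriMuDatum.{u, v, w} l G X k} →
    SplitIso D D' → SplitIso D' D'' → SplitIso D D''
  | _, .bad _, .bad _, .bad _, f, f' => NonarchTriMuDatum.SplitIso.trans f f'
  | _, .good _, .good _, .good _, f, f' => NonarchTriMuDatum.SplitIso.trans f f'
  | _, .arch _, .arch _, .arch _, f, f' => ⟨ArchTriMuDatum.SplitIso.trans f.down f'.down⟩

/-- Inverse. [cite: Mochizuki2012, Def 4.9 (vii) p.158] -/
def SplitIso.symm : {k : PlaceKind} → {D D' : LocalTriMuDatum.{u, v, w} l G X k} → SplitIso D D' → SplitIso D' D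
  | _, .bad _, .bad _, f => NonarchTriMuDatum.SplitIso.symm f
  | _, .good _, .good _, f => NonarchTriMuDatum.SplitIso.symm f
  | _, .arch _, .arch _, f => ⟨ArchTriMuDatum.SplitIso.symm f.down⟩

/-- The `×μ`-component, by type of place. [cite: Mochizuki2012, Def 4.9 (vii) p.158] -/
def SplitIso.toMuIso : {k : PlaceKind} → {D D' : LocalTriMuDatum.{u, v, w} l G X k} → SplitIso D D' → MuIso D D'
  | _, .bad _, .bad _, f => NonarchTriMuDatum.SplitIso.toMuIso f
  | _, .good _, .good _, f => NonarchTriMuDatum.SplitIso.toMuIso f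
  | _, .arch _, .arch _, f => ⟨ArchTriMuDatum.SplitIso.toMuIso f.down⟩

/-- `O^▷`-level isomorphisms induce split isomorphisms, by type of place. [cite: Mochizuki2012, Def 4.9 (vii) p.158] -/
def Iso.toSplitIso : {k : PlaceKind} → {D D' : LocalTriMuDatum.{u, v, w} l G X k} → Iso D D' → SplitIso D D'
  | _, .bad _, .bad _, f => NonarchTriMuDatum.Iso.toSplitIso f
  | _, .good _, .good _, f => NonarchTriMuDatum.Iso.toSplitIso f
  | _, .arch _, .arch _, f => ⟨ArchTriMuDatum.Iso.toSplitIso f.down⟩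

variable {k : PlaceKind} {D D' D'' D''' : LocalTriMuDatum.{u, v, w} l G X k}

/-- `refl ≫ f = f`. (bookkeeping). [cite: Mochizuki2012, Def 4.9 (vii) p.158] -/
theorem SplitIso.refl_trans (f : SplitIso D D') : (SplitIso.refl D).trans f = f := by
  cases D <;> cases D' <;> first
    | exact NonarchTriMuDatum.SplitIso.refl_trans f
    | exact congrArg ULift.up (ArchTriMuDatum.SplitIso.refl_trans f.down)

/-- `f ≫ refl = f`. (bookkeeping). [cite: Mochizuki2012, Def 4.9 (vii) p.158] -/
theorem SplitIso.trans_refl (f : SplitIso D D') : f.trans (SplitIso.refl D') = f := by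
  cases D <;> cases D' <;> first
    | exact NonarchTriMuDatum.SplitIso.trans_refl f
    | exact congrArg ULift.up (ArchTriMuDatum.SplitIso.trans_refl f.down)

/-- Associativity. (bookkeeping). [cite: Mochizuki2012, Def 4.9 (vii) p.158] -/
theorem SplitIso.trans_assoc (f : SplitIso D D') (f' : SplitIso D' D'') (f'' : SplitIso D'' D''') :
    (f.trans f').trans f'' = f.trans (f'.trans f'') := by
  cases D <;> cases D' <;> cases D'' <;> cases D''' <;> first
    | exact NonarchTriMuDatum.SplitIso.trans_assoc f f' f''
    | exact congrArg ULift.up (ArchTriMuDatum.SplitIso.trans_assoc f.down f'.down f''.down)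

/-- `f ≫ f⁻¹ = refl`. (bookkeeping). [cite: Mochizuki2012, Def 4.9 (vii) p.158] -/
theorem SplitIso.trans_symm (f : SplitIso D D') : f.trans f.symm = SplitIso.refl D := by
  cases D <;> cases D' <;> first
    | exact NonarchTriMuDatum.SplitIso.trans_symm f
    | exact congrArg ULift.up (ArchTriMuDatum.SplitIso.trans_symm f.down)

/-- `f⁻¹ ≫ f = refl`. (bookkeeping). [cite: Mochizuki2012, Def 4.9 (vii) p.158] -/
theorem SplitIso.symm_trans (f : SplitIso D D') : f.symm.trans f = SplitIso.refl D' := by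
  cases D <;> cases D' <;> first
    | exact NonarchTriMuDatum.SplitIso.symm_trans f
    | exact congrArg ULift.up (ArchTriMuDatum.SplitIso.symm_trans f.down)

/-- `toMuIso` respects identities. (bookkeeping). [cite: Mochizuki2012, Def 4.9 (vii) p.158] -/
theorem SplitIso.toMuIso_refl (D : LocalTriMuDatum.{u, v, w} l G X k) :
    (SplitIso.refl D).toMuIso = MuIso.refl D := by
  cases D <;> rfl

/-- `toMuIso` respects composition. (bookkeeping). [cite: Mochizuki2012, Def 4.9 (vii) p.158] -/
theorem SplitIso.toMuIso_trans (f : SplitIso D D') (f' : SplitIso D' D'') :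
    (f.trans f').toMuIso = f.toMuIso.trans f'.toMuIso := by
  cases D <;> cases D' <;> cases D'' <;> rfl

/-- `toSplitIso` then `toMuIso` is `toMuIso`. (bookkeeping). [cite: Mochizuki2012, Def 4.9 (vii) p.158] -/
theorem Iso.toMuIso_toSplitIso (f : Iso D D') : f.toSplitIso.toMuIso = f.toMuIso := by
  cases D <;> cases D' <;> rfl

/-- `toSplitIso` respects identities. (bookkeeping). [cite: Mochizuki2012, Def 4.9 (vii) p.158] -/
theorem Iso.toSplitIso_refl (D : LocalTriMuDatum.{u, v, w} l G X k) :
    (Iso.refl D).toSplitIso = SplitIso.refl D := by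
  cases D <;> first
    | exact NonarchTriMuDatum.Iso.toSplitIso_refl _
    | exact congrArg ULift.up (ArchTriMuDatum.Iso.toSplitIso_refl _)

/-- `toSplitIso` respects composition. (bookkeeping). [cite: Mochizuki2012, Def 4.9 (vii) p.158] -/
theorem Iso.toSplitIso_trans (f : Iso D D') (f' : Iso D' D'') :
    (f.trans f').toSplitIso = f.toSplitIso.trans f'.toSplitIso := by
  cases D <;> cases D' <;> cases D'' <;> first
    | exact NonarchTriMuDatum.Iso.toSplitIso_trans f f'
    | exact congrArg ULift.up (ArchTriMuDatum.Iso.toSplitIso_trans f.down f'.down)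

/-- **Surjectivity of "passing to `F^{⊢×μ}`" on print-level isomorphisms, by type of place**, given one split
isomorphism. PROVED. [cite: Mochizuki2012, Def 4.9 (vii) p.158] -/
theorem SplitIso.toMuIso_surjective_of_nonempty (h : Nonempty (SplitIso D D')) :
    Function.Surjective (SplitIso.toMuIso : SplitIso D D' → MuIso D D') := by
  cases D <;> cases D' <;> first
    | exact NonarchTriMuDatum.SplitIso.toMuIso_surjective_of_nonempty h
    | exact fun m => h.elim fun s => ⟨⟨⟨s.down.eTri, m.down⟩⟩, rfl⟩

/-- … in particular whenever an `O^▷`-level isomorphism exists. [cite: Mochizuki2012, Def 4.9 (vii) p.158] -/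
theorem SplitIso.toMuIso_surjective_of_iso (f : Iso D D') :
    Function.Surjective (SplitIso.toMuIso : SplitIso D D' → MuIso D D') :=
  SplitIso.toMuIso_surjective_of_nonempty ⟨f.toSplitIso⟩

end LocalTriMuDatum

end Literature.IUT.HodgeArakelov
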